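import Mathlib
import Literature.Analysis.FluidPDE.SelfSimilarEulerProfile
import HarnessLib.Audit

/-!
# Rung C1 of the crux `EulerZoomLiouville.PowerGaugeEulerLiouville` (sub-stratum W3b): THE LINEAR STRAIN IS A NON-CONSTANT
# SELF-SIMILAR EULER PROFILE OF LINEAR GROWTH FOR EVERY EXPONENT — sharpness of the sublinear rigidity theorem

Route №10 `EulerZoomLiouville` (NavierStokesRegularity), crux E = stmt-NavierStokesRegularity-19832, tenure rung C1,
registered residue `stub_selfSimilarExtremalRest`, sub-stratum W3b.  Lineage ns-typeII-p1 (gen 8).  Companion of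
`…SelfSimilarSublinearLoc` (`Loc.eq_const_of_sublinear`: a `C²` profile of CIV (3.3) with `0 < γ < ½` and `U(y) = o(|y|)` is
constant).  Here: the growth hypothesis `o(|y|)` cannot be relaxed to `O(|y|)` at PROFILE level.

The planar linear strain `U(y) = ⟪e₀, y⟫ e₀ − ⟪e₁, y⟫ e₁ = Ay`, `A = e₀e₀ᵀ − e₁e₁ᵀ` (symmetric, trace-free), with the
pressure `P(y) = −⟪e₀, y⟫² = −½ yᵀ(A + A²)y`, solves `(1−γ)U + DU[γy + U] + ∇P = (A + A²)y + ∇P = 0`, `div U = tr A = 0`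
for EVERY `γ ∈ ℝ`; it is `C^∞`, of linear growth `‖U y‖ ≤ 2‖y‖`, and not constant.  (In physical variables it is the
classical stagnation-point flow `u(x, τ) = Ax/(−τ)`, an exact infinite-energy Euler solution blowing up at `τ = 0`; as a
member of the crux's class it is excluded by the `A`-gauge, `∫_{B_L}|U|² ≍ L⁵ ≫ L^{1−2ρ}` — i.e. only at MEMBER level.)

* `exists_linearGrowth_nonconst_profile` — for every `γ`, a `C^∞` solution `(U, P)` of CIV (3.3) centred at `0` with
  `‖U y‖ ≤ 2‖y‖` which is NOT constant;
* `not_rigid_of_linearGrowth` — hence «`C²` profile of (3.3), `0 < γ < ½`, `‖U y‖ ≤ C‖y‖` ⇒ `U` constant» is FALSE: the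
  sublinear hypothesis of `Loc.eq_const_of_sublinear` is the exact profile-level frontier.

WHAT THIS IS NOT: not NS, not E, not a class member (infinite energy, fails the gauge) — a MODEL profile delimiting the
profile-level rigidity; nothing here asserts NS regularity or blow-up. [folklore; ConstantinIgnatovaVicol2026Putative §3.1
eq. (3.3) (setting); MajdaBertozziCUP2002 §1.4 (strain flows as exact solutions)]
-/

noncomputable section

-- flat `Theorems/<Route><Decl>…` files of one crux share the namespace of the crux (tree convention)
set_option linter.dupNamespace false

open Set Function InnerProductSpace
open scoped RealInnerProductSpace ContDiff

namespace Summit.NavierStokesRegularity.NavierStokesRegularity.Theorems.PowerGaugeEulerLiouville.LinearStrain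

open Literature.Analysis Literature.Analysis.FluidPDE

/-- **The linear strain `U = e₀e₀ᵀ − e₁e₁ᵀ` with pressure `P = −⟪e₀,y⟫²` is a non-constant `C^∞` self-similar Euler profile
(CIV (3.3), centre `0`) of linear growth, for EVERY exponent `γ`.** [folklore; ConstantinIgnatovaVicol2026Putative §3.1 eq. (3.3) (the equation); MajdaBertozziCUP2002 §1.4 (strain flows)] -/
theorem exists_linearGrowth_nonconst_profile (γ : ℝ) :
    ∃ (U : EuclideanSpace ℝ (Fin 3) → EuclideanSpace ℝ (Fin 3)) (P : EuclideanSpace ℝ (Fin 3) → ℝ),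
      IsSelfSimilarEulerProfile γ 0 U P ∧ ContDiff ℝ ∞ U ∧ (∀ y, ‖U y‖ ≤ 2 * ‖y‖) ∧ ¬ (∀ x y, U x = U y) := by
  set b : OrthonormalBasis (Fin 3) ℝ (EuclideanSpace ℝ (Fin 3)) := EuclideanSpace.basisFun (Fin 3) ℝ with hb
  set e₀ : EuclideanSpace ℝ (Fin 3) := b 0 with he₀
  set e₁ : EuclideanSpace ℝ (Fin 3) := b 1 with he₁
  have hon := b.orthonormal
  have h00 : ⟪e₀, e₀⟫ = 1 := by rw [orthonormal_iff_ite.1 hon 0 0]; simp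
  have h11 : ⟪e₁, e₁⟫ = 1 := by rw [orthonormal_iff_ite.1 hon 1 1]; simp
  have h01 : ⟪e₀, e₁⟫ = 0 := by rw [orthonormal_iff_ite.1 hon 0 1]; simp
  have h10 : ⟪e₁, e₀⟫ = 0 := by rw [orthonormal_iff_ite.1 hon 1 0]; simp
  have hn0 : ‖e₀‖ = 1 := hon.1 0
  have hn1 : ‖e₁‖ = 1 := hon.1 1
  -- the velocity as a continuous linear map
  set A : EuclideanSpace ℝ (Fin 3) →L[ℝ] EuclideanSpace ℝ (Fin 3) :=
    (innerSL ℝ e₀).smulRight e₀ - (innerSL ℝ e₁).smulRight e₁ with hA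
  have hAapp : ∀ v, A v = ⟪e₀, v⟫ • e₀ - ⟪e₁, v⟫ • e₁ := fun v => by
    simp [hA, ContinuousLinearMap.smulRight_apply, innerSL_apply_apply]
  set U : EuclideanSpace ℝ (Fin 3) → EuclideanSpace ℝ (Fin 3) := fun y => A y with hU
  set P : EuclideanSpace ℝ (Fin 3) → ℝ := fun y => -(⟪e₀, y⟫ * ⟪e₀, y⟫) with hP
  have hUA : U = ⇑A := rfl
  have hDU : ∀ y, fderiv ℝ U y = A := fun y => by rw [hUA]; exact A.fderiv
  -- the pressure gradient `∇P(y) = −2⟪e₀,y⟫ e₀`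
  have hPd : ∀ y, HasFDerivAt P (-((⟪e₀, y⟫) • innerSL ℝ e₀ + (⟪e₀, y⟫) • innerSL ℝ e₀)) y := by
    intro y
    have hL : HasFDerivAt (fun z : EuclideanSpace ℝ (Fin 3) => ⟪e₀, z⟫) (innerSL ℝ e₀) y := by
      simpa using (innerSL ℝ e₀).hasFDerivAt
    have h := (hL.mul hL).neg
    exact h
  have hP1 : ContDiff ℝ 1 P := by
    have h : ContDiff ℝ 1 fun z : EuclideanSpace ℝ (Fin 3) => ⟪e₀, z⟫ := (innerSL ℝ e₀).contDiff
    exact (h.mul h).neg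
  have hgrad : ∀ y, gradient P y = -((2 * ⟪e₀, y⟫) • e₀) := by
    intro y
    have h := hPd y
    have hG : HasGradientAt P (-((2 * ⟪e₀, y⟫) • e₀)) y := by
      rw [hasGradientAt_iff_hasFDerivAt]
      refine h.congr_fderiv ?_
      ext v
      simp only [neg_apply, add_apply, FunLike.coe_smul,
        Pi.smul_apply, innerSL_apply_apply, smul_eq_mul, map_neg, map_smul, InnerProductSpace.toDual_apply_apply]
      ring
    exact hG.gradient
  refine ⟨U, P, ⟨A.contDiff.of_le le_top, hP1, fun y => ?_, fun y => ?_⟩, A.contDiff, fun y => ?_, ?_⟩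
  · -- the profile equation (3.3)
    rw [hDU y, hgrad y]
    simp only [hU, hAapp, sub_zero, inner_add_right, inner_sub_right, inner_smul_right, h00, h01, h10, h11]
    module
  · -- incompressibility: `tr A = ⟪e₀,e₀⟫² + … = 1 − 1 = 0`
    rw [divergence_eq_sum_inner_fderiv b, hDU y, Fin.sum_univ_three]
    have h02 : ⟪e₀, b 2⟫ = 0 := by rw [he₀, orthonormal_iff_ite.1 hon 0 2]; simp
    have h12 : ⟪e₁, b 2⟫ = 0 := by rw [he₁, orthonormal_iff_ite.1 hon 1 2]; simp
    simp only [hAapp, ← he₀, ← he₁, inner_sub_right, inner_smul_right, h00, h01, h10, h11, h02, h12]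
    ring
  · -- linear growth
    rw [hU]
    dsimp only
    rw [hAapp]
    calc ‖⟪e₀, y⟫ • e₀ - ⟪e₁, y⟫ • e₁‖ ≤ ‖⟪e₀, y⟫ • e₀‖ + ‖⟪e₁, y⟫ • e₁‖ := norm_sub_le _ _
      _ = |⟪e₀, y⟫| + |⟪e₁, y⟫| := by rw [norm_smul, norm_smul, hn0, hn1, Real.norm_eq_abs, Real.norm_eq_abs]; ring
      _ ≤ ‖e₀‖ * ‖y‖ + ‖e₁‖ * ‖y‖ := add_le_add (abs_real_inner_le_norm _ _) (abs_real_inner_le_norm _ _)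
      _ = 2 * ‖y‖ := by rw [hn0, hn1]; ring
  · -- not constant: `U e₀ = e₀ ≠ 0 = U 0`
    intro hconst
    have h := hconst e₀ 0
    rw [hU] at h
    dsimp only at h
    rw [hAapp, hAapp, h00, h10] at h
    simp only [one_smul, zero_smul, sub_zero, inner_zero_right] at h
    have : ‖e₀‖ = 0 := by rw [h]; simp
    rw [hn0] at this
    exact one_ne_zero this

/-- **The sublinear growth hypothesis of `Loc.eq_const_of_sublinear` is sharp at profile level**: it is FALSE that every
`C²` self-similar Euler profile with `0 < γ < ½` and LINEAR growth `‖U y‖ ≤ C‖y‖` is constant (witness: the linear strain,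
`γ = 2/5`).  Linear-growth profiles are excluded only at member level (by the `A`-gauge). [folklore] -/
theorem not_rigid_of_linearGrowth :
    ¬ ∀ (γ : ℝ) (U : EuclideanSpace ℝ (Fin 3) → EuclideanSpace ℝ (Fin 3)) (P : EuclideanSpace ℝ (Fin 3) → ℝ),
      0 < γ → γ < 1 / 2 → IsSelfSimilarEulerProfile γ 0 U P → (∃ C : ℝ, ∀ y, ‖U y‖ ≤ C * ‖y‖) →
        ∀ x y, U x = U y := by
  intro h
  obtain ⟨U, P, hprof, -, hgr, hnc⟩ := exists_linearGrowth_nonconst_profile (2 / 5)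
  exact hnc (h (2 / 5) U P (by norm_num) (by norm_num) hprof ⟨2, hgr⟩)

end Summit.NavierStokesRegularity.NavierStokesRegularity.Theorems.PowerGaugeEulerLiouville.LinearStrain

end
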